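import Mathlib
import Literature.Combinatorics.Enumerative.InvolutionsAvoiding4321And312
import Literature.Combinatorics.Enumerative.InvolutionsAvoiding3412
import HarnessLib

/-!
# Fixed-point-free involutions avoiding `312`: `|DI_{2h}(312)| = |DI_{2h}(3412, 312)| = 2^{h−1}` (Barnabei–Bonetti–Silimbani 2011, Theorem 12 (b))

Layer `Literature/Combinatorics/Enumerative`, namespace `Literature.Combinatorics.Enumerative.PermContainsPattern`; lane
`lit-hodgefound` (prover seat p13, generation 39, theme «nonnesting / noncrossing matchings and restricted
involutions»).  Sequel of `InvolutionsAvoiding4321And312.lean` (the last letter of a `312`-avoiding involution lies in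
a reversed final block) and `InvolutionsAvoiding231.lean` (Simion–Schmidt Proposition 6: `312`-avoiding involutions
are layered).

## Source

M. Barnabei, F. Bonetti, M. Silimbani, *Restricted involutions and Motzkin paths*, Adv. Appl. Math. **47** (2011)
102–115 = arXiv:0812.0463 [BarnabeiBonettiSilimbani2011] (held text `paper-arxiv-0812.0463`, arXiv numbering, §6):

> **Theorem 12.** For every integer `n`, we have: … b. `|DI_{2h}(3412,312)| = 2^{h−1}`.
> Proof. b. Remark that `DI_{2h}(3412,312) = DI_{2h}(312)`. Involutions in `I_{2h}(312)` without fixed points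
> correspond bijectively to Dyck paths whose irreducible components are of type `U^a D^a` (see Theorem 4). These paths
> are encoded by the compositions of `2h` into even parts.

## Formalisation (arc language; theorems only)

* §1 `contains_312_of_contains_3412` (so `DI_n(3412, 312) = DI_n(312)`), `revPerm_fixedPointFree_iff` (a reversal of
  `d + 1` letters has no fixed point iff `d` is odd).
* §2 ★ `exists_eq_directSum_revPerm`: a `312`-avoiding involution whose last letter is exchanged with the letter `m`
  is `τ ⊕ rev_{d+1}`, `τ ∈ I_m(312)` (as in `InvolutionsAvoiding4321And312.lean`, without the `4321` constraint);
  fibres of `DI_{m+d+1}(312)` over the partner of the last letter: `DI_m(312)` for `d` odd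
  (`card_fpf_av312_lastBlock`), empty for `d` even (`card_fpf_av312_lastBlock_even`).
* §3 ★★ `card_fpf_av312_succ_eq_sum` (`g_{n+1} = Σ_{t ≤ n, n − t odd} g_t`), `card_fpf_av312_add_two`
  (`g_{N+2} = 2 g_N`, `N ≥ 1`), ★★★ THEOREM 12 (b): `card_fpf_av312_two_mul : |DI_{2h+2}(312)| = 2^h`,
  `card_fpf_av312_odd`, and `card_fpf_av3412_av312_two_mul : |DI_{2h+2}(3412, 312)| = 2^h`.
-/

namespace Literature.Combinatorics.Enumerative

namespace PermContainsPattern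

open Finset Equiv

variable {n m : ℕ}

/-! ### §1 `3412 ⊇ 312`; fixed points of a reversal -/

/-- An occurrence of `3412` contains an occurrence of `312` (drop the `4`); hence `312`-avoiders avoid `3412` and
`DI_n(3412, 312) = DI_n(312)`. [cite: BarnabeiBonettiSilimbani2011, Theorem 12 (b) (proof: «`DI_{2h}(3412,312) = DI_{2h}(312)`»; arXiv 0812.0463)] -/
theorem contains_312_of_contains_3412 {v : Perm (Fin n)} (h : PermContainsPattern v ![3, 4, 1, 2]) :
    PermContainsPattern v ![3, 1, 2] := by
  obtain ⟨a, b, c, d, hab, hbc, hcd, h1, h2, h3⟩ := (contains_3412_iff v).1 h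
  exact (contains_312_iff v).2 ⟨a, c, d, hab.trans hbc, hcd, h1, h2⟩

/-- A reversal of `d + 1` letters has no fixed point iff `d` is odd (the middle letter `d/2` is fixed for even `d`).
[cite: BarnabeiBonettiSilimbani2011, Theorem 12 (b) (proof: «compositions of `2h` into even parts»; arXiv 0812.0463)] -/
theorem revPerm_fixedPointFree_iff (d : ℕ) : (∀ y : Fin (d + 1), Fin.revPerm y ≠ y) ↔ d % 2 = 1 := by
  constructor
  · intro h
    by_contra hd
    refine h ⟨d / 2, by omega⟩ (Fin.ext ?_)
    rw [Fin.revPerm_apply, Fin.val_rev]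
    change d + 1 - (d / 2 + 1) = d / 2
    omega
  · intro hd y e
    have := congrArg Fin.val e
    rw [Fin.revPerm_apply, Fin.val_rev] at this
    omega

/-! ### §2 The last reversed block of a `312`-avoiding involution -/

/-- ★ **The last block.** A `312`-avoiding involution of `[0, m+d]` whose last letter is exchanged with the letter `m` is
`τ ⊕ rev_{d+1}` for a `312`-avoiding involution `τ` of `[0, m)`: the block `[m, last]` is mapped into itself
decreasingly (Simion–Schmidt), so it is reversed, and its complement is permuted among itself.
[cite: BarnabeiBonettiSilimbani2011, Proposition 4 and Theorem 12 (b) (arXiv 0812.0463)]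
[cite: SimionSchmidt1985, Proposition 6 (held text p0009)] -/
theorem exists_eq_directSum_revPerm (m d : ℕ) {u : Perm (Fin (m + (d + 1)))} (hinv : u * u = 1)
    (h312 : ¬ PermContainsPattern u ![3, 1, 2]) (hlast : ((u (Fin.natAdd m (Fin.last d)) : ℕ)) = m) :
    ∃ τ : Perm (Fin m), (τ * τ = 1 ∧ ¬ PermContainsPattern τ ![3, 1, 2]) ∧
      u = finSumFinEquiv.symm.trans ((τ.sumCongr (Fin.revPerm : Perm (Fin (d + 1)))).trans finSumFinEquiv) := by
  have hu : ∀ x, u (u x) = x := (mul_self_eq_one_iff_apply_apply u).1 hinv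
  have h231 : ¬ PermContainsPattern u ![2, 3, 1] := ((involution_and_av312_iff u).1 ⟨hinv, h312⟩).1
  have hl : u (Fin.natAdd m (Fin.last d)) = Fin.natAdd m 0 := Fin.ext (by rw [hlast]; simp)
  have hl' : u (Fin.natAdd m 0) = Fin.natAdd m (Fin.last d) := by rw [← hl, hu]
  have hblock : ∀ q : Fin (m + (d + 1)), m ≤ (q : ℕ) → m ≤ ((u q : Fin (m + (d + 1))) : ℕ) := by
    intro q hq
    rcases (show q = Fin.natAdd m 0 ∨ q = Fin.natAdd m (Fin.last d) ∨
        (Fin.natAdd m 0 < q ∧ q < Fin.natAdd m (Fin.last d)) from by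
      rcases lt_trichotomy q (Fin.natAdd m 0) with h | h | h
      · exact absurd (Fin.lt_def.1 h) (by simp; omega)
      · exact Or.inl h
      · rcases lt_trichotomy q (Fin.natAdd m (Fin.last d)) with h' | h' | h'
        · exact Or.inr (Or.inr ⟨h, h'⟩)
        · exact Or.inr (Or.inl h')
        · exact absurd (Fin.lt_def.1 h') (by have := q.2; simp [Fin.val_last]; omega)) with rfl | rfl | ⟨h1, h2⟩
    · rw [hl']; simp
    · rw [hl]; simp
    · have := (apply_mem_Ioo_of_av231_av312 h231 h312 h1 (by rw [hl']; exact h2)).1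
      have := Fin.lt_def.1 this
      simp at this
      omega
  have hlow : ∀ i : Fin m, ((u (Fin.castAdd (d + 1) i)) : ℕ) < m := by
    intro i
    by_contra hc
    push Not at hc
    have := hblock (u (Fin.castAdd (d + 1) i)) hc
    rw [hu, Fin.val_castAdd] at this
    exact absurd i.2 (not_lt.2 this)
  obtain ⟨τ, ρ, hσ⟩ := exists_eq_directSum u hlow
  have hρ231 : ¬ PermContainsPattern ρ ![2, 3, 1] := fun h => h231 (hσ ▸ trans (directSum_contains_right τ ρ) h)
  have hρ312 : ¬ PermContainsPattern ρ ![3, 1, 2] := fun h => h312 (hσ ▸ trans (directSum_contains_right τ ρ) h)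
  have hρ0 : ρ 0 = Fin.last d := by
    have := hl'
    rw [hσ, directSum_apply_natAdd] at this
    exact Fin.natAdd_injective _ _ this
  have hρ : ρ = Fin.revPerm := eq_revPerm_of_strictAnti fun p q hpq =>
    apply_lt_apply_of_av231_av312 hρ231 hρ312 (Fin.zero_le p) hpq (by rw [hρ0]; exact Fin.le_last q)
  subst hρ
  refine ⟨τ, ⟨((directSum_mul_self_eq_one_iff τ _).1 (hσ ▸ hinv)).1,
    fun h => h312 (hσ ▸ trans (directSum_contains_left τ _) h)⟩, hσ⟩

/-- ★ For `d` odd, the fixed-point-free `312`-avoiding involutions of `[0, m+d]` whose last letter is exchanged with the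
letter `m` (final block `U^a D^a`, `2a = d + 1`) are the `τ ⊕ rev_{d+1}`, `τ ∈ DI_m(312)`.
[cite: BarnabeiBonettiSilimbani2011, Theorem 12 (b) (arXiv 0812.0463)] -/
theorem card_fpf_av312_lastBlock (m d : ℕ) (hd : d % 2 = 1) :
    Nat.card {u : Perm (Fin (m + (d + 1))) // ((u * u = 1 ∧ ¬ PermContainsPattern u ![3, 1, 2]) ∧ ∀ i, u i ≠ i) ∧
        ((u (Fin.natAdd m (Fin.last d)) : ℕ)) = m} =
      Nat.card {τ : Perm (Fin m) // (τ * τ = 1 ∧ ¬ PermContainsPattern τ ![3, 1, 2]) ∧ ∀ i, τ i ≠ i} := by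
  have hrev : (Fin.revPerm : Perm (Fin (d + 1))) * Fin.revPerm = 1 := revPerm_mul_revPerm'
  have hq3 : (![3, 1, 2] : Fin 3 → ℕ) (Fin.last 2) < (![3, 1, 2] : Fin 3 → ℕ) 0 := by decide
  have hrfp := (revPerm_fixedPointFree_iff d).2 hd
  refine (Nat.card_congr (Equiv.ofBijective (fun τ : {τ : Perm (Fin m) // (τ * τ = 1 ∧
      ¬ PermContainsPattern τ ![3, 1, 2]) ∧ ∀ i, τ i ≠ i} =>
    (⟨finSumFinEquiv.symm.trans ((τ.1.sumCongr (Fin.revPerm : Perm (Fin (d + 1)))).trans finSumFinEquiv),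
      ⟨⟨(directSum_mul_self_eq_one_iff τ.1 _).2 ⟨τ.2.1.1, hrev⟩,
        not_contains_directSum hq3 τ.2.1.2 (revPerm_not_contains_312 _)⟩, fun i => by
          induction i using Fin.addCases with
          | left i => rw [Ne, directSum_apply_eq_self_iff_castAdd]; exact τ.2.2 i
          | right j => rw [Ne, directSum_apply_eq_self_iff_natAdd]; exact hrfp j⟩,
      by rw [directSum_apply_natAdd, Fin.revPerm_apply, Fin.rev_last, Fin.val_natAdd, Fin.val_zero, add_zero]⟩ :
    {u : Perm (Fin (m + (d + 1))) // ((u * u = 1 ∧ ¬ PermContainsPattern u ![3, 1, 2]) ∧ ∀ i, u i ≠ i) ∧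
      ((u (Fin.natAdd m (Fin.last d)) : ℕ)) = m})) ⟨?_, ?_⟩)).symm
  · rintro ⟨τ, hτ⟩ ⟨τ', hτ'⟩ h
    have h2 := Prod.ext_iff.mp (directSum_injective m (d + 1) (a₁ := (τ, Fin.revPerm)) (a₂ := (τ', Fin.revPerm))
      (congrArg Subtype.val h))
    exact Subtype.ext h2.1
  · rintro ⟨u, ⟨⟨hinv, h312⟩, hfp⟩, hlast⟩
    obtain ⟨τ, hτ, rfl⟩ := exists_eq_directSum_revPerm m d hinv h312 hlast
    refine ⟨⟨τ, hτ, fun i hi => hfp (Fin.castAdd (d + 1) i) ?_⟩, rfl⟩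
    rw [directSum_apply_eq_self_iff_castAdd]; exact hi

/-- For `d` even the fibre is empty: the final reversed block of `d + 1` letters has a fixed point.
[cite: BarnabeiBonettiSilimbani2011, Theorem 12 (b) (arXiv 0812.0463)] -/
theorem card_fpf_av312_lastBlock_even (m d : ℕ) (hd : d % 2 = 0) :
    Nat.card {u : Perm (Fin (m + (d + 1))) // ((u * u = 1 ∧ ¬ PermContainsPattern u ![3, 1, 2]) ∧ ∀ i, u i ≠ i) ∧
        ((u (Fin.natAdd m (Fin.last d)) : ℕ)) = m} = 0 := by
  rw [Nat.card_eq_zero]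
  left
  refine ⟨fun ⟨u, ⟨⟨hinv, h312⟩, hfp⟩, hlast⟩ => ?_⟩
  obtain ⟨τ, -, rfl⟩ := exists_eq_directSum_revPerm m d hinv h312 hlast
  have hfix : ¬ ∀ y : Fin (d + 1), Fin.revPerm y ≠ y := fun h => by
    have := (revPerm_fixedPointFree_iff d).1 h; omega
  push Not at hfix
  obtain ⟨y, hy⟩ := hfix
  exact hfp (Fin.natAdd m y) ((directSum_apply_eq_self_iff_natAdd τ _ y).2 hy)

/-! ### §3 The recurrence and THEOREM 12 (b) -/

/-- Splitting a finite subtype along a statistic with values in a `Fintype`. [folklore] -/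
private theorem card_subtype_eq_sum_fiber₇ {α β : Type*} [Finite α] [Fintype β] (P : α → Prop) (f : α → β) :
    Nat.card {x // P x} = ∑ t : β, Nat.card {x // P x ∧ f x = t} := by
  rw [← Nat.card_sigma]
  exact Nat.card_congr ((Equiv.sigmaFiberEquiv fun x : {x // P x} => f x.1).symm.trans
    (Equiv.sigmaCongrRight fun t => Equiv.subtypeSubtypeEquivSubtypeInter P fun x => f x = t))

/-- ★★ **The recurrence** `g_{n+1} = Σ_{t ≤ n, n − t odd} g_t`: sort `DI_{n+1}(312)` by the partner `t` of the last
letter; the final reversed block `[t, n]` must have even size. [cite: BarnabeiBonettiSilimbani2011, Theorem 12 (b) (arXiv 0812.0463)] -/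
theorem card_fpf_av312_succ_eq_sum (n : ℕ) :
    Nat.card {u : Perm (Fin (n + 1)) // (u * u = 1 ∧ ¬ PermContainsPattern u ![3, 1, 2]) ∧ ∀ i, u i ≠ i} =
      ∑ t ∈ range (n + 1), if (n - t) % 2 = 1 then
        Nat.card {u : Perm (Fin t) // (u * u = 1 ∧ ¬ PermContainsPattern u ![3, 1, 2]) ∧ ∀ i, u i ≠ i} else 0 := by
  rw [card_subtype_eq_sum_fiber₇ (fun u : Perm (Fin (n + 1)) => (u * u = 1 ∧ ¬ PermContainsPattern u ![3, 1, 2]) ∧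
    ∀ i, u i ≠ i) (fun u => u (Fin.last n)), ← Fin.sum_univ_eq_sum_range (fun t => if (n - t) % 2 = 1 then
      Nat.card {u : Perm (Fin t) // (u * u = 1 ∧ ¬ PermContainsPattern u ![3, 1, 2]) ∧ ∀ i, u i ≠ i} else 0) (n + 1)]
  refine Finset.sum_congr rfl fun t _ => ?_
  obtain ⟨t, ht⟩ := t
  obtain ⟨d, rfl⟩ : ∃ d, n = t + d := ⟨n - t, by omega⟩
  simp only [Fin.val_mk]
  rw [show t + d - t = d by omega]
  have e : Nat.card {u : Perm (Fin (t + d + 1)) // ((u * u = 1 ∧ ¬ PermContainsPattern u ![3, 1, 2]) ∧ ∀ i, u i ≠ i) ∧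
      u (Fin.last (t + d)) = ⟨t, ht⟩} = Nat.card {u : Perm (Fin (t + (d + 1))) // ((u * u = 1 ∧
        ¬ PermContainsPattern u ![3, 1, 2]) ∧ ∀ i, u i ≠ i) ∧ ((u (Fin.natAdd t (Fin.last d)) : ℕ)) = t} := by
    refine Nat.card_congr (Equiv.subtypeEquivRight fun u => and_congr_right fun _ => ?_)
    rw [Fin.ext_iff, Fin.val_mk, show (Fin.last (t + d) : Fin (t + d + 1)) = Fin.natAdd t (Fin.last d) from
      Fin.ext (by simp)]
  rw [e]
  split_ifs with hd
  · exact card_fpf_av312_lastBlock t d hd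
  · exact card_fpf_av312_lastBlock_even t d (by omega)

/-- `g_0 = 1`. [cite: BarnabeiBonettiSilimbani2011, Theorem 12 (b) (arXiv 0812.0463)] -/
theorem card_fpf_av312_zero :
    Nat.card {u : Perm (Fin 0) // (u * u = 1 ∧ ¬ PermContainsPattern u ![3, 1, 2]) ∧ ∀ i, u i ≠ i} = 1 := by
  have : Unique {u : Perm (Fin 0) // (u * u = 1 ∧ ¬ PermContainsPattern u ![3, 1, 2]) ∧ ∀ i, u i ≠ i} :=
    { default := ⟨1, ⟨by simp, not_contains_of_lt _ _ (by norm_num)⟩, fun i => Fin.elim0 i⟩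
      uniq := fun u => Subtype.ext (Equiv.ext fun x => Fin.elim0 x) }
  exact Nat.card_unique

/-- `g_1 = 0`. [cite: BarnabeiBonettiSilimbani2011, Theorem 12 (b) (arXiv 0812.0463)] -/
theorem card_fpf_av312_one :
    Nat.card {u : Perm (Fin 1) // (u * u = 1 ∧ ¬ PermContainsPattern u ![3, 1, 2]) ∧ ∀ i, u i ≠ i} = 0 := by
  rw [card_fpf_av312_succ_eq_sum, sum_range_one, if_neg (by norm_num)]

/-- `g_2 = 1` (the transposition). [cite: BarnabeiBonettiSilimbani2011, Theorem 12 (b) (arXiv 0812.0463)] -/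
theorem card_fpf_av312_two :
    Nat.card {u : Perm (Fin 2) // (u * u = 1 ∧ ¬ PermContainsPattern u ![3, 1, 2]) ∧ ∀ i, u i ≠ i} = 1 := by
  rw [card_fpf_av312_succ_eq_sum, sum_range_succ, sum_range_one, if_pos (by norm_num), if_neg (by norm_num), add_zero,
    card_fpf_av312_zero]

/-- ★★ `g_{N+2} = 2 g_N` for `N ≥ 1`: the fibres of `DI_{N+2}(312)` over `t < N` are those of `DI_N(312)` (same parity
of the final block), plus the fibre `t = N` (final block `UD`) worth `g_N`, plus the empty fibre `t = N + 1`.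
[cite: BarnabeiBonettiSilimbani2011, Theorem 12 (b) (arXiv 0812.0463)] -/
theorem card_fpf_av312_add_two (N : ℕ) (hN : 1 ≤ N) :
    Nat.card {u : Perm (Fin (N + 2)) // (u * u = 1 ∧ ¬ PermContainsPattern u ![3, 1, 2]) ∧ ∀ i, u i ≠ i} =
      2 * Nat.card {u : Perm (Fin N) // (u * u = 1 ∧ ¬ PermContainsPattern u ![3, 1, 2]) ∧ ∀ i, u i ≠ i} := by
  obtain ⟨M, rfl⟩ := Nat.exists_eq_add_of_le' hN
  rw [show M + 1 + 2 = (M + 2) + 1 by ring, card_fpf_av312_succ_eq_sum (M + 2), sum_range_succ, sum_range_succ,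
    show M + 2 - (M + 1) = 1 by omega, show M + 2 - (M + 2) = 0 by omega, if_pos rfl, if_neg (by omega), add_zero,
    two_mul]
  congr 1
  rw [card_fpf_av312_succ_eq_sum M]
  refine Finset.sum_congr rfl fun t ht => ?_
  rw [show (M + 2 - t) % 2 = (M - t) % 2 by have := mem_range.1 ht; omega]

/-- ★★★ **THEOREM 12 (b) (Barnabei–Bonetti–Silimbani): `|DI_{2h+2}(312)| = 2^h`** — the fixed-point-free `312`-avoiding
(layered) involutions are the compositions of `2h + 2` into even parts. [cite: BarnabeiBonettiSilimbani2011, Theorem 12 (b) (arXiv 0812.0463)] -/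
theorem card_fpf_av312_two_mul (h : ℕ) :
    Nat.card {u : Perm (Fin (2 * h + 2)) // (u * u = 1 ∧ ¬ PermContainsPattern u ![3, 1, 2]) ∧ ∀ i, u i ≠ i} = 2 ^ h := by
  induction h with
  | zero => exact card_fpf_av312_two
  | succ h ih =>
    rw [show 2 * (h + 1) + 2 = (2 * h + 2) + 2 by ring, card_fpf_av312_add_two _ (by omega), ih, pow_succ, mul_comm]

/-- No fixed-point-free involution of an odd number of letters: `|DI_{2h+1}(312)| = 0`. [cite: BarnabeiBonettiSilimbani2011, §6 (arXiv 0812.0463)] -/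
theorem card_fpf_av312_odd (h : ℕ) :
    Nat.card {u : Perm (Fin (2 * h + 1)) // (u * u = 1 ∧ ¬ PermContainsPattern u ![3, 1, 2]) ∧ ∀ i, u i ≠ i} = 0 := by
  induction h with
  | zero => exact card_fpf_av312_one
  | succ h ih =>
    rw [show 2 * (h + 1) + 1 = (2 * h + 1) + 2 by ring, card_fpf_av312_add_two _ (by omega), ih]

/-- ★★ `DI_n(3412, 312) = DI_n(312)`, so `|DI_{2h+2}(3412, 312)| = 2^h` as printed (`|DI_{2h}(3412,312)| = 2^{h−1}`).
[cite: BarnabeiBonettiSilimbani2011, Theorem 12 (b) (arXiv 0812.0463)] -/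
theorem card_fpf_av3412_av312_two_mul (h : ℕ) :
    Nat.card {u : Perm (Fin (2 * h + 2)) // (u * u = 1 ∧ ¬ PermContainsPattern u ![3, 4, 1, 2] ∧
      ¬ PermContainsPattern u ![3, 1, 2]) ∧ ∀ i, u i ≠ i} = 2 ^ h := by
  rw [← card_fpf_av312_two_mul h]
  refine Nat.card_congr (Equiv.subtypeEquivRight fun u => and_congr_left fun _ => ?_)
  constructor
  · rintro ⟨hinv, -, h312⟩; exact ⟨hinv, h312⟩
  · rintro ⟨hinv, h312⟩; exact ⟨hinv, fun h => h312 (contains_312_of_contains_3412 h), h312⟩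

/-- Values: `|DI_n(312)| = 1, 0, 1, 0, 2, 0, 4, 0, 8` for `n = 0, …, 8`. [cite: BarnabeiBonettiSilimbani2011, Theorem 12 (b) (arXiv 0812.0463)] -/
theorem card_fpf_av312_values :
    [Nat.card {u : Perm (Fin 0) // (u * u = 1 ∧ ¬ PermContainsPattern u ![3, 1, 2]) ∧ ∀ i, u i ≠ i},
      Nat.card {u : Perm (Fin (2 * 0 + 2)) // (u * u = 1 ∧ ¬ PermContainsPattern u ![3, 1, 2]) ∧ ∀ i, u i ≠ i},
      Nat.card {u : Perm (Fin (2 * 1 + 2)) // (u * u = 1 ∧ ¬ PermContainsPattern u ![3, 1, 2]) ∧ ∀ i, u i ≠ i},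
      Nat.card {u : Perm (Fin (2 * 2 + 2)) // (u * u = 1 ∧ ¬ PermContainsPattern u ![3, 1, 2]) ∧ ∀ i, u i ≠ i},
      Nat.card {u : Perm (Fin (2 * 3 + 2)) // (u * u = 1 ∧ ¬ PermContainsPattern u ![3, 1, 2]) ∧ ∀ i, u i ≠ i}] =
      [1, 1, 2, 4, 8] := by
  rw [card_fpf_av312_zero, card_fpf_av312_two_mul, card_fpf_av312_two_mul, card_fpf_av312_two_mul,
    card_fpf_av312_two_mul]
  decide

end PermContainsPattern

end Literature.Combinatorics.Enumerative
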